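import Summits.ValiantsHypothesis.ValiantsHypothesis.Theorems.KPlusLogSqLawTropicalSymmetricOrbitThreeFourPairsDD

/-!
# Route «KPlusLogSqLaw» — the symmetric `(3,4)` tropical row in the ORBIT model — abstract exclusion lemmas, part 4:
# towards the orbit core V2 (`{0,0,3}, {0,2,3}, {1,1,2}, {1,2,2}` not all carried): two identity terms `{0,0,3}`, `{0,2,3}`

HONEST FRAMING.  Helper file (seat val-sym-lift-p2 (g6), cell `pub-symmetroid`, 2026-08-27; `--supports` the `WeakLifting` item
stmt-ValiantsHypothesis-19561 as a helper, no closure claim).  A SMALL-FORMAT statement in the transpose-ORBIT carrier model, far inside the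
known regime of the cruxes; port blueprint `HOME/val-sym-lift-p2/g6/LEMMA-Z-liftp2g6.md` §6–§7 (typed case tree `exp/casetree_V2orb.txt`).
Nothing here is about `TropicalB` / `WeakLifting` in their windows, Conjecture B, DoorA34 = `PosRootLawAt 3 4 18` (OPEN, never asserted),
`MatrixDescartes` (stmt-ValiantsHypothesis-18050) or VP ≠ VNP; `TSymOrb34Le17` / `TSymOrb34Le16` stay targets (NOT asserted).

THIS FILE.  `DD_frame3` (`{0,0,3} = D(x)` and `{0,2,3} = D(w)` ⇒ `x` before `w`, `w = x` with one `0` raised to `2`), and the killers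
`K7` (`{1,2,2} = T`), `K6` (`{1,2,2} = C`), `K5` (`{1,1,2} = C`) against these two identity terms (R1/R3 cancellations on the three pairs).
[cell statement R1732; folklore-level exchange arguments, no citation exists]
-/

set_option linter.dupNamespace false
set_option autoImplicit false

namespace Summit.ValiantsHypothesis.ValiantsHypothesis.Theorems.KPlusLogSqLaw

open Summit.ValiantsHypothesis.ValiantsHypothesis.Theorems.MatrixDescartes.Negative
open Summit.ValiantsHypothesis.ValiantsHypothesis.Theorems.LacunarySymmetroidMatrixDescartes
open Summit.ValiantsHypothesis.ValiantsHypothesis.Theorems.LacunarySymmetroidMatrixDescartes.TropicalCensus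
open Finset

namespace SymmetricOrbitThreeFour

open SymmetricThreeFour SymmetricThreeFourSeventeen SymmetricThreeFourSixteen SymmetricThreeFourFifteen

/-- **`DD_frame3`**: if `{0,0,3} = D(x)` (index `z`) and `{0,2,3} = D(w)` (index `b`) are both carried, then `z < b` and there are pairwise
distinct columns `p, q, κ` with `x p = x q = 0`, `x κ = 3`, `w κ = 3`, and `{w p, w q} = {0, 2}` (stated as: `w p = 0 ∧ w q = 2`, after
possibly swapping `p, q`). [hM for identity carriers] -/
theorem DD_frame3 {n : ℕ} (r : Fin (n + 1) → Equiv.Perm (Fin 3) × (Fin 3 → Fin 4))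
    (hM : ∀ a b : Fin (n + 1), a < b → ∀ l₁ l₂ : Fin 3,
      ((r a).1 l₁ = (r b).1 l₂ ∧ l₁ = l₂) ∨ ((r a).1 l₁ = l₂ ∧ (r b).1 l₂ = l₁) → (r a).2 l₁ ≤ (r b).2 l₂)
    (z b : Fin (n + 1)) (hz1 : (r z).1 = 1) (hb1 : (r b).1 = 1)
    (hz : TropicalCensus.classSym (r z) = TropicalCensus.classSym ((1 : Equiv.Perm (Fin 3)), (![0, 0, 3] : Fin 3 → Fin 4)))
    (hb : TropicalCensus.classSym (r b) = TropicalCensus.classSym ((1 : Equiv.Perm (Fin 3)), (![0, 2, 3] : Fin 3 → Fin 4))) :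
    z < b ∧ ∃ p q κ : Fin 3, p ≠ q ∧ κ ≠ p ∧ κ ≠ q ∧ (r z).2 p = 0 ∧ (r z).2 q = 0 ∧ (r z).2 κ = 3 ∧
      (r b).2 p = 0 ∧ (r b).2 q = 2 ∧ (r b).2 κ = 3 := by
  have cz : ∀ l, (univ.filter fun t => (r z).2 t = l).card = (![2, 0, 0, 1] : Fin 4 → ℕ) l :=
    fun l => (card_filter_eq_of_classSym_eq hz l).trans (cnt003 l)
  have cb : ∀ l, (univ.filter fun t => (r b).2 t = l).card = (![1, 0, 1, 1] : Fin 4 → ℕ) l :=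
    fun l => (card_filter_eq_of_classSym_eq hb l).trans (cnt023 l)
  have hzb : z ≠ b := by intro h; have := cz 0; rw [h, cb 0] at this; exact absurd this (by decide)
  have hMD : ∀ x y : Fin (n + 1), x < y → (r x).1 = 1 → (r y).1 = 1 → ∀ l, (r x).2 l ≤ (r y).2 l :=
    fun x y hxy hx hy l => hM x y hxy l l (Or.inl ⟨by rw [hx, hy], rfl⟩)
  obtain ⟨κ, hκ⟩ := exists_of_card_pos ((r z).2) 3 (by rw [cz 3]; decide)
  obtain ⟨p₀, q₀, hpq₀, hp₀, hq₀⟩ := exists_pair_of_card_two ((r z).2) 0 (cz 0)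
  have hκp : κ ≠ p₀ := by rintro rfl; rw [hκ] at hp₀; exact absurd hp₀ (by decide)
  have hκq : κ ≠ q₀ := by rintro rfl; rw [hκ] at hq₀; exact absurd hq₀ (by decide)
  have wb1 : ∀ t, (r b).2 t ≠ 1 := ne_of_card_zero _ 1 (by rw [cb 1]; rfl)
  have hlt : z < b := by
    rcases lt_or_gt_of_ne hzb with h | h
    · exact h
    · exfalso
      -- `w ≤ x`: the `2` and the `3` of `w` both need `x ≥ 2`, but only `x κ = 3`
      obtain ⟨t2, ht2⟩ := exists_of_card_pos ((r b).2) 2 (by rw [cb 2]; decide)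
      obtain ⟨t3, ht3⟩ := exists_of_card_pos ((r b).2) 3 (by rw [cb 3]; decide)
      have h2 := hMD b z h hb1 hz1 t2; rw [ht2] at h2
      have h3 := hMD b z h hb1 hz1 t3; rw [ht3] at h3
      have x2 : ∀ t, 2 ≤ (r z).2 t → t = κ := by
        intro t ht
        by_contra hne
        have h3 := ne_of_card_one _ 3 (by rw [cz 3]; rfl) hκ hne
        rcases f4_c _ (ne_of_card_zero ((r z).2) 1 (by rw [cz 1]; rfl) t)
            (ne_of_card_zero ((r z).2) 2 (by rw [cz 2]; rfl) t) with h0 | h0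
        · rw [h0] at ht; exact absurd ht (by decide)
        · exact h3 h0
      have e2 := x2 t2 h2
      have e3 := x2 t3 (le_trans (by decide) h3)
      rw [← e2] at e3; rw [e3, ht2] at ht3
      exact absurd ht3 (by decide)
  have hw3 : (r b).2 κ = 3 := by
    have := hMD z b hlt hz1 hb1 κ; rw [hκ] at this; exact le_antisymm (Fin.le_last _) this
  have hwp3 : (r b).2 p₀ ≠ 3 := ne_of_card_one _ 3 (by rw [cb 3]; rfl) hw3 hκp.symm
  have hwq3 : (r b).2 q₀ ≠ 3 := ne_of_card_one _ 3 (by rw [cb 3]; rfl) hw3 hκq.symm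
  -- `{w p₀, w q₀} = {0, 2}`
  by_cases hp0 : (r b).2 p₀ = 0
  · have hq2 : (r b).2 q₀ = 2 :=
      f4_j _ (ne_of_card_one _ 0 (by rw [cb 0]; rfl) hp0 hpq₀.symm) (wb1 q₀) hwq3
    exact ⟨hlt, p₀, q₀, κ, hpq₀, hκp, hκq, hp₀, hq₀, hκ, hp0, hq2, hw3⟩
  · have hp2 : (r b).2 p₀ = 2 := f4_j _ hp0 (wb1 p₀) hwp3
    have hq0 : (r b).2 q₀ = 0 := by
      have hne2 : (r b).2 q₀ ≠ 2 := ne_of_card_one _ 2 (by rw [cb 2]; rfl) hp2 hpq₀.symm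
      rcases f4_c _ (wb1 q₀) hne2 with h | h
      · exact h
      · exact absurd h hwq3
    exact ⟨hlt, q₀, p₀, κ, hpq₀.symm, hκq, hκp, hq₀, hp₀, hκ, hq0, hp2, hw3⟩

/-- **`K7`**: `{0,0,3} = D`, `{0,2,3} = D`, `{1,2,2} = T` is impossible. [orbY2 + R1w / R1′w at the fixed column of the transposition] -/
theorem K7 {n : ℕ} (r : Fin (n + 1) → Equiv.Perm (Fin 3) × (Fin 3 → Fin 4)) (g : Fin 4 → ℕ) (hmono : Monotone g)
    (hM : ∀ a b : Fin (n + 1), a < b → ∀ l₁ l₂ : Fin 3,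
      ((r a).1 l₁ = (r b).1 l₂ ∧ l₁ = l₂) ∨ ((r a).1 l₁ = l₂ ∧ (r b).1 l₂ = l₁) → (r a).2 l₁ ≤ (r b).2 l₂)
    (hR1 : ∀ a b : Fin (n + 1), a < b → (r a).1 = 1 → ∀ i j : Fin 3, i ≠ j → (r b).1 = Equiv.swap i j → (r b).2 i = (r b).2 j →
      g ((r a).2 i) + g ((r a).2 j) < 2 * g ((r b).2 i))
    (hR1' : ∀ a b : Fin (n + 1), a < b → (r b).1 = 1 → ∀ i j : Fin 3, i ≠ j → (r a).1 = Equiv.swap i j → (r a).2 i = (r a).2 j →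
      2 * g ((r a).2 i) < g ((r b).2 i) + g ((r b).2 j))
    (z b e : Fin (n + 1)) (hz1 : (r z).1 = 1) (hb1 : (r b).1 = 1)
    (hzc : TropicalCensus.classSym (r z) = TropicalCensus.classSym ((1 : Equiv.Perm (Fin 3)), (![0, 0, 3] : Fin 3 → Fin 4)))
    (hbc : TropicalCensus.classSym (r b) = TropicalCensus.classSym ((1 : Equiv.Perm (Fin 3)), (![0, 2, 3] : Fin 3 → Fin 4)))
    (hec : TropicalCensus.classSym (r e) = TropicalCensus.classSym ((1 : Equiv.Perm (Fin 3)), (![1, 2, 2] : Fin 3 → Fin 4)))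
    {i j : Fin 3} (hij : i < j) (he1 : (r e).1 = Equiv.swap i j) (hee : (r e).2 i = (r e).2 j) : False := by
  obtain ⟨-, p, q, κ, hpq, hκp, hκq, xp, xq, xκ, -, -, -⟩ := DD_frame3 r hM z b hz1 hb1 hzc hbc
  have cz : ∀ l, (univ.filter fun t => (r z).2 t = l).card = (![2, 0, 0, 1] : Fin 4 → ℕ) l :=
    fun l => (card_filter_eq_of_classSym_eq hzc l).trans (cnt003 l)
  have ce : ∀ l, (univ.filter fun t => (r e).2 t = l).card = (![0, 1, 2, 0] : Fin 4 → ℕ) l :=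
    fun l => (card_filter_eq_of_classSym_eq hec l).trans (cnt122 l)
  have y2 := orbY2 r g hmono hM hR1 hR1' b e hb1 hbc hec (Or.inr ⟨i, j, hij, he1, hee⟩)
  have g02 : g 0 ≤ g 2 := hmono (by decide)
  have hij' : i ≠ j := ne_of_lt hij
  obtain ⟨k, hki, hkj⟩ := exists_third i j
  have e_only : ∀ l, (r e).2 l = 1 ∨ (r e).2 l = 2 := fun l => by
    by_cases h1 : (r e).2 l = 1
    · exact Or.inl h1
    · exact Or.inr (f4_j _ (ne_of_card_zero _ 0 (by rw [ce 0]; rfl) l) h1 (ne_of_card_zero _ 3 (by rw [ce 3]; rfl) l))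
  obtain ⟨hei, hek⟩ := swap_letters r e hij' hki hkj hee 1 2 (by rw [ce 1]; rfl) (by rw [ce 2]; rfl) e_only
  have x03 : ∀ t, (r z).2 t = 0 ∨ (r z).2 t = 3 := fun t =>
    f4_c _ (ne_of_card_zero _ 1 (by rw [cz 1]; rfl) t) (ne_of_card_zero _ 2 (by rw [cz 2]; rfl) t)
  have x3κ : ∀ t, (r z).2 t = 3 → t = κ := fun t ht => by
    by_contra hne; exact ne_of_card_one _ 3 (by rw [cz 3]; rfl) xκ hne ht
  have hze : z ≠ e := by intro h; have := cz 0; rw [h, ce 0] at this; exact absurd this (by decide)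
  have hek' : (r e).1 k = k := by rw [he1, Equiv.swap_apply_of_ne_of_ne hki hkj]
  rcases lt_or_gt_of_ne hze with hlt | hlt
  · -- D before T: `x k ≤ 1` so `k ≠ κ`; the swapped pair contains `κ`: `g 0 + g 3 < 2 g 2`
    have hle := hM z e hlt k k (Or.inl ⟨by rw [hz1, hek', Equiv.Perm.one_apply], rfl⟩)
    rw [hek] at hle
    have hkκ : k ≠ κ := by rintro rfl; rw [xκ] at hle; exact absurd hle (by decide)
    have hC := hR1 z e hlt hz1 i j hij' he1 hee
    rw [hei] at hC
    rcases eq_or_eq_of_ne_third i j k κ hij' hki.symm hkj.symm hkκ.symm with hκi | hκj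
    · rw [← hκi, xκ] at hC
      have hj0 : (r z).2 j = 0 := by
        rcases x03 j with h | h
        · exact h
        · exact absurd (x3κ j h) (by rw [hκi]; exact hij'.symm)
      rw [hj0] at hC; omega
    · rw [← hκj, xκ] at hC
      have hi0 : (r z).2 i = 0 := by
        rcases x03 i with h | h
        · exact h
        · exact absurd (x3κ i h) (by rw [hκj]; exact hij')
      rw [hi0] at hC; omega
  · -- T before D: `1 ≤ x k` so `k = κ`; the swapped pair carries `0, 0`: `2 g 2 < 2 g 0`
    have hle := hM e z hlt k k (Or.inl ⟨by rw [hz1, hek', Equiv.Perm.one_apply], rfl⟩)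
    rw [hek] at hle
    have hkκ : k = κ := by
      rcases x03 k with h | h
      · rw [h] at hle; exact absurd hle (by decide)
      · exact x3κ k h
    have hC := hR1' e z hlt hz1 i j hij' he1 hee
    rw [hei] at hC
    have hi0 : (r z).2 i = 0 := by
      rcases x03 i with h | h
      · exact h
      · exact absurd ((x3κ i h).trans hkκ.symm) hki.symm
    have hj0 : (r z).2 j = 0 := by
      rcases x03 j with h | h
      · exact h
      · exact absurd ((x3κ j h).trans hkκ.symm) hkj.symm
    rw [hi0, hj0] at hC; omega

/-- letters of a pair carrier on `{1,2,2}` / `{1,1,2}`: all in `{1, 2}`. -/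
theorem letters12 {n : ℕ} (r : Fin (n + 1) → Equiv.Perm (Fin 3) × (Fin 3 → Fin 4)) (y : Fin (n + 1))
    (h0 : (univ.filter fun t => (r y).2 t = 0).card = 0) (h3 : (univ.filter fun t => (r y).2 t = 3).card = 0) :
    ∀ t, (r y).2 t = 1 ∨ (r y).2 t = 2 := fun t => by
  by_cases h1 : (r y).2 t = 1
  · exact Or.inl h1
  · exact Or.inr (f4_j _ (ne_of_card_zero _ 0 h0 t) h1 (ne_of_card_zero _ 3 h3 t))

/-- **`K6`**: `{0,0,3} = D`, `{0,2,3} = D`, `{1,2,2} = C` is impossible. [R3w / R3′w on the three pairs] -/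
theorem K6 {n : ℕ} (r : Fin (n + 1) → Equiv.Perm (Fin 3) × (Fin 3 → Fin 4)) (g : Fin 4 → ℕ) (hmono : Monotone g)
    (hM : ∀ a b : Fin (n + 1), a < b → ∀ l₁ l₂ : Fin 3,
      ((r a).1 l₁ = (r b).1 l₂ ∧ l₁ = l₂) ∨ ((r a).1 l₁ = l₂ ∧ (r b).1 l₂ = l₁) → (r a).2 l₁ ≤ (r b).2 l₂)
    (hR3 : ∀ a b : Fin (n + 1), a < b → (r a).1 = 1 → ∀ i j k : Fin 3, i ≠ j → k ≠ i → k ≠ j →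
      (r b).1 i = j → (r b).1 j = k → (r b).1 k = i → g ((r a).2 i) + g ((r a).2 j) < 2 * g ((r b).2 i))
    (hR3' : ∀ a b : Fin (n + 1), a < b → (r b).1 = 1 → ∀ i j k : Fin 3, i ≠ j → k ≠ i → k ≠ j →
      (r a).1 i = j → (r a).1 j = k → (r a).1 k = i → 2 * g ((r a).2 i) < g ((r b).2 i) + g ((r b).2 j))
    (z b y : Fin (n + 1)) (hz1 : (r z).1 = 1) (hb1 : (r b).1 = 1) (hy : ∀ x, (r y).1 x ≠ x)
    (hzc : TropicalCensus.classSym (r z) = TropicalCensus.classSym ((1 : Equiv.Perm (Fin 3)), (![0, 0, 3] : Fin 3 → Fin 4)))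
    (hbc : TropicalCensus.classSym (r b) = TropicalCensus.classSym ((1 : Equiv.Perm (Fin 3)), (![0, 2, 3] : Fin 3 → Fin 4)))
    (hyc : TropicalCensus.classSym (r y) = TropicalCensus.classSym ((1 : Equiv.Perm (Fin 3)), (![1, 2, 2] : Fin 3 → Fin 4))) : False := by
  obtain ⟨-, p, q, κ, hpq, hκp, hκq, xp, xq, xκ, wp, wq, wκ⟩ := DD_frame3 r hM z b hz1 hb1 hzc hbc
  have cy : ∀ l, (univ.filter fun t => (r y).2 t = l).card = (![0, 1, 2, 0] : Fin 4 → ℕ) l :=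
    fun l => (card_filter_eq_of_classSym_eq hyc l).trans (cnt122 l)
  have y12 := letters12 r y (by rw [cy 0]; rfl) (by rw [cy 3]; rfl)
  have gy1 : ∀ t, g 1 ≤ g ((r y).2 t) := fun t => by rcases y12 t with h | h <;> rw [h]; exact hmono (by decide)
  have gy2 : ∀ t, g ((r y).2 t) ≤ g 2 := fun t => by rcases y12 t with h | h <;> rw [h]; exact hmono (by decide)
  have y_ne1 : ∀ {t t' : Fin 3}, (r y).2 t = 1 → t' ≠ t → (r y).2 t' = 2 := fun {t t'} h hne => by
    rcases y12 t' with h' | h'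
    · exact absurd h' (ne_of_card_one _ 1 (by rw [cy 1]; rfl) h hne)
    · exact h'
  have g01 : g 0 ≤ g 1 := hmono (by decide)
  have g02 : g 0 ≤ g 2 := hmono (by decide)
  have g23 : g 2 ≤ g 3 := hmono (by decide)
  have hzy : z ≠ y := by intro h; rw [h] at hz1; exact fpf_ne_one hy hz1
  have hby : b ≠ y := by intro h; rw [h] at hb1; exact fpf_ne_one hy hb1
  rcases fpf_orient (r y).1 hy p q hpq with hor | hor
  · -- carrier `p ↦ q ↦ κ ↦ p`
    obtain ⟨hqκ, hκp'⟩ := fpf_next (r y).1 hy p q κ hpq hκp hκq hor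
    have hzy' : z < y := by
      rcases lt_or_gt_of_ne hzy with h | h
      · exact h
      · exfalso
        have hC := hR3' y z h hz1 p q κ hpq hκp hκq hor hqκ hκp'
        rw [xp, xq] at hC; have := gy1 p; omega
    have hyb' : y < b := by
      rcases lt_or_gt_of_ne hby with h | h
      · exfalso
        have hC := hR3 b y h hb1 q κ p hκq.symm hpq hκp.symm hqκ hκp' hor
        rw [wq, wκ] at hC; have := gy2 q; omega
      · exact h
    have c1 := hR3' y b hyb' hb1 p q κ hpq hκp hκq hor hqκ hκp'
    rw [wp, wq] at c1
    have hyp : (r y).2 p = 1 := by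
      rcases y12 p with h | h
      · exact h
      · rw [h] at c1; omega
    have c2 := hR3 z y hzy' hz1 κ p q hκp (fun h => hκq h.symm) (fun h => hpq h.symm) hκp' hor hqκ
    rw [xκ, xp, y_ne1 hyp hκp] at c2
    have c3 := hR3' y b hyb' hb1 κ p q hκp (fun h => hκq h.symm) (fun h => hpq h.symm) hκp' hor hqκ
    rw [wκ, wp, y_ne1 hyp hκp] at c3
    omega
  · -- carrier `q ↦ p ↦ κ ↦ q`
    obtain ⟨hpκ, hκq'⟩ := fpf_next (r y).1 hy q p κ hpq.symm hκq hκp hor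
    have hzy' : z < y := by
      rcases lt_or_gt_of_ne hzy with h | h
      · exact h
      · exfalso
        have hC := hR3' y z h hz1 q p κ hpq.symm hκq hκp hor hpκ hκq'
        rw [xq, xp] at hC; have := gy1 q; omega
    have hyb' : y < b := by
      rcases lt_or_gt_of_ne hby with h | h
      · exfalso
        have hC := hR3 b y h hb1 κ q p hκq (fun h => hκp h.symm) hpq hκq' hor hpκ
        rw [wκ, wq] at hC; have := gy2 κ; omega
      · exact h
    have c1 := hR3' y b hyb' hb1 q p κ hpq.symm hκq hκp hor hpκ hκq'
    rw [wq, wp] at c1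
    have hyq : (r y).2 q = 1 := by
      rcases y12 q with h | h
      · exact h
      · rw [h] at c1; omega
    have c2 := hR3 z y hzy' hz1 p κ q (fun h => hκp h.symm) (fun h => hpq h.symm) (fun h => hκq h.symm) hpκ hκq' hor
    rw [xp, xκ, y_ne1 hyq hpq] at c2
    have c3 := hR3' y b hyb' hb1 p κ q (fun h => hκp h.symm) (fun h => hpq h.symm) (fun h => hκq h.symm) hpκ hκq' hor
    rw [wp, wκ, y_ne1 hyq hpq] at c3
    omega

/-- **`K5`**: `{0,0,3} = D`, `{0,2,3} = D`, `{1,1,2} = C` is impossible. [R3w / R3′w on the three pairs] -/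
theorem K5 {n : ℕ} (r : Fin (n + 1) → Equiv.Perm (Fin 3) × (Fin 3 → Fin 4)) (g : Fin 4 → ℕ) (hmono : Monotone g)
    (hM : ∀ a b : Fin (n + 1), a < b → ∀ l₁ l₂ : Fin 3,
      ((r a).1 l₁ = (r b).1 l₂ ∧ l₁ = l₂) ∨ ((r a).1 l₁ = l₂ ∧ (r b).1 l₂ = l₁) → (r a).2 l₁ ≤ (r b).2 l₂)
    (hR3 : ∀ a b : Fin (n + 1), a < b → (r a).1 = 1 → ∀ i j k : Fin 3, i ≠ j → k ≠ i → k ≠ j →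
      (r b).1 i = j → (r b).1 j = k → (r b).1 k = i → g ((r a).2 i) + g ((r a).2 j) < 2 * g ((r b).2 i))
    (hR3' : ∀ a b : Fin (n + 1), a < b → (r b).1 = 1 → ∀ i j k : Fin 3, i ≠ j → k ≠ i → k ≠ j →
      (r a).1 i = j → (r a).1 j = k → (r a).1 k = i → 2 * g ((r a).2 i) < g ((r b).2 i) + g ((r b).2 j))
    (z b y : Fin (n + 1)) (hz1 : (r z).1 = 1) (hb1 : (r b).1 = 1) (hy : ∀ x, (r y).1 x ≠ x)
    (hzc : TropicalCensus.classSym (r z) = TropicalCensus.classSym ((1 : Equiv.Perm (Fin 3)), (![0, 0, 3] : Fin 3 → Fin 4)))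
    (hbc : TropicalCensus.classSym (r b) = TropicalCensus.classSym ((1 : Equiv.Perm (Fin 3)), (![0, 2, 3] : Fin 3 → Fin 4)))
    (hyc : TropicalCensus.classSym (r y) = TropicalCensus.classSym ((1 : Equiv.Perm (Fin 3)), (![1, 1, 2] : Fin 3 → Fin 4))) : False := by
  obtain ⟨-, p, q, κ, hpq, hκp, hκq, xp, xq, xκ, wp, wq, wκ⟩ := DD_frame3 r hM z b hz1 hb1 hzc hbc
  have cy : ∀ l, (univ.filter fun t => (r y).2 t = l).card = (![0, 2, 1, 0] : Fin 4 → ℕ) l :=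
    fun l => (card_filter_eq_of_classSym_eq hyc l).trans (cnt112 l)
  have y12 := letters12 r y (by rw [cy 0]; rfl) (by rw [cy 3]; rfl)
  have gy1 : ∀ t, g 1 ≤ g ((r y).2 t) := fun t => by rcases y12 t with h | h <;> rw [h]; exact hmono (by decide)
  have gy2 : ∀ t, g ((r y).2 t) ≤ g 2 := fun t => by rcases y12 t with h | h <;> rw [h]; exact hmono (by decide)
  have y_ne2 : ∀ {t t' : Fin 3}, (r y).2 t = 2 → t' ≠ t → (r y).2 t' = 1 := fun {t t'} h hne => by
    rcases y12 t' with h' | h'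
    · exact h'
    · exact absurd h' (ne_of_card_one _ 2 (by rw [cy 2]; rfl) h hne)
  have g01 : g 0 ≤ g 1 := hmono (by decide)
  have g12 : g 1 ≤ g 2 := hmono (by decide)
  have g23 : g 2 ≤ g 3 := hmono (by decide)
  have hzy : z ≠ y := by intro h; rw [h] at hz1; exact fpf_ne_one hy hz1
  have hby : b ≠ y := by intro h; rw [h] at hb1; exact fpf_ne_one hy hb1
  rcases fpf_orient (r y).1 hy p q hpq with hor | hor
  · obtain ⟨hqκ, hκp'⟩ := fpf_next (r y).1 hy p q κ hpq hκp hκq hor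
    have hzy' : z < y := by
      rcases lt_or_gt_of_ne hzy with h | h
      · exact h
      · exfalso
        have hC := hR3' y z h hz1 p q κ hpq hκp hκq hor hqκ hκp'
        rw [xp, xq] at hC; have := gy1 p; omega
    have hyb' : y < b := by
      rcases lt_or_gt_of_ne hby with h | h
      · exfalso
        have hC := hR3 b y h hb1 q κ p hκq.symm hpq hκp.symm hqκ hκp' hor
        rw [wq, wκ] at hC; have := gy2 q; omega
      · exact h
    have c1 := hR3' y b hyb' hb1 p q κ hpq hκp hκq hor hqκ hκp'
    rw [wp, wq] at c1
    have hyp : (r y).2 p = 1 := by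
      rcases y12 p with h | h
      · exact h
      · rw [h] at c1; omega
    rw [hyp] at c1
    -- one of the other two letters is `1`: it sits on a pair of `x` with letters `0, 3`
    have c2 := hR3 z y hzy' hz1 κ p q hκp (fun h => hκq h.symm) (fun h => hpq h.symm) hκp' hor hqκ
    rw [xκ, xp] at c2
    have c3 := hR3 z y hzy' hz1 q κ p hκq.symm hpq hκp.symm hqκ hκp' hor
    rw [xq, xκ] at c3
    rcases y12 q with hq1 | hq2
    · rw [hq1] at c3; omega
    · rw [y_ne2 hq2 hκq] at c2; omega
  · obtain ⟨hpκ, hκq'⟩ := fpf_next (r y).1 hy q p κ hpq.symm hκq hκp hor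
    have hzy' : z < y := by
      rcases lt_or_gt_of_ne hzy with h | h
      · exact h
      · exfalso
        have hC := hR3' y z h hz1 q p κ hpq.symm hκq hκp hor hpκ hκq'
        rw [xq, xp] at hC; have := gy1 q; omega
    have hyb' : y < b := by
      rcases lt_or_gt_of_ne hby with h | h
      · exfalso
        have hC := hR3 b y h hb1 κ q p hκq (fun h => hκp h.symm) hpq hκq' hor hpκ
        rw [wκ, wq] at hC; have := gy2 κ; omega
      · exact h
    have c1 := hR3' y b hyb' hb1 q p κ hpq.symm hκq hκp hor hpκ hκq'
    rw [wq, wp] at c1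
    have hyq : (r y).2 q = 1 := by
      rcases y12 q with h | h
      · exact h
      · rw [h] at c1; omega
    rw [hyq] at c1
    have c2 := hR3 z y hzy' hz1 p κ q (fun h => hκp h.symm) (fun h => hpq h.symm) (fun h => hκq h.symm) hpκ hκq' hor
    rw [xp, xκ] at c2
    have c3 := hR3 z y hzy' hz1 κ q p hκq (fun h => hκp h.symm) hpq hκq' hor hpκ
    rw [xκ, xq] at c3
    rcases y12 p with hp1 | hp2
    · rw [hp1] at c2; omega
    · rw [y_ne2 hp2 hκp] at c3; omega

end SymmetricOrbitThreeFour

end Summit.ValiantsHypothesis.ValiantsHypothesis.Theorems.KPlusLogSqLaw
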